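import Mathlib
import HarnessLib
import Summits.Ventures.LatticeQCDFlow.Exactness.PopulationLeaveOneOutExact

/-!
# LatticeQCDFlow / Exactness — LEARNING ON THE JOB, X: POPULATION MOVES THAT COPY ARE NOT EXACT, MOVES THAT PERMUTE ARE — swapping walkers
# keeps the product target; cloning a walker onto another, or replacing a walker by a fresh UNTESTED flow draw, does not

HONEST FRAMING: exact (Metropolis-corrected) sampling algorithms for lattice gauge theory;
figures of merit are autocorrelation/cost numbers at stated couplings and volumes; no
continuum-physics claim.

Venture `LatticeQCDFlow` (cell pub-lqcd), topic `Exactness`, FANOUT row 30 (lean-1 GEN-44, theme LEARNING ON THE JOB).  Companion of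
`PopulationLeaveOneOutExact` ∕ `PopulationSimultaneousBias` on the other population moves a training loop is tempted to make.  NEW WORK of
the cell; no definition is introduced, nothing is cited as a fact.  Tree inputs: `PopulationLeaveOneOutExact` (`leaveOneOut_fst_invariant`
for the tested refresh), Mathlib (`Measure.prod_swap`, `deterministic_comp_eq_map`).  Printed counterparts NAMED ONLY: resampling ∕
selection steps of population Monte Carlo and SMC, which are exact only WITH importance weights (Del Moral–Doucet–Jasra 2006).

## Setting
Two walkers with the same target: `Ω × Ω`, `π ⊗ π`.  Def-free kernels on the pair: the SWAP `T(x, x') = δ_{(x', x)}`; the CLONE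
`C(x, x') = δ_{(x', x')}` (overwrite walker 1 with a copy of walker 2 — "replace the worst walker by the best"); the UNTESTED REFRESH
`R(x, x') = q ⊗ δ_{x'}` (overwrite walker 1 with a fresh draw from the flow `q`, no accept ∕ reject).

## Results (no `sorry`)
* §1 **`swapWalkers_invariant`** — the swap leaves `π ⊗ π` invariant (`Measure.prod_swap`): relabelling walkers is free.
* §2 **`cloneWalker_bind_apply`** — after a clone the pair has law `A ×ˢ B ↦ π(A ∩ B)` (both walkers equal); **`cloneWalker_not_invariant`**
  — NOT exact as soon as `π` charges a set and its complement (any non-degenerate target): the population collapses onto the diagonal.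
* §3 **`untestedRefresh_bind_eq`** — after an untested refresh from the flow the pair has law `q ⊗ π`; **`untestedRefresh_not_invariant`** —
  NOT exact unless the flow IS the target (`q ≠ π` witnessed on one set); **`testedRefresh_invariant`** — the same refresh passed through the
  flow sampler's accept ∕ reject step (walker 1 updated by any `π`-exact kernel not reading walker 2) IS exact (`PopulationLeaveOneOutExact`).
Reading (gauge files): in a population of chains used to train a flow, re-seeding a chain from the flow or from another chain without a
Metropolis test (or importance weights) breaks exactness of that chain's stream; permuting chains, or re-seeding THROUGH the accept step,
does not.
-/

namespace Summit.Ventures.LatticeQCDFlow.Exactness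

open MeasureTheory ProbabilityTheory
open scoped _root_.ENNReal

variable {Ω : Type*} [MeasurableSpace Ω] {π : Measure Ω}

/-! ## §1 Permuting walkers is exact -/

/-- **THE SWAP IS EXACT**: any kernel `T` with `T(p) = δ_{swap p}` leaves `π ⊗ π` invariant. [ours] -/
theorem swapWalkers_invariant [SFinite π] (T : Kernel (Ω × Ω) (Ω × Ω))
    (hT : ∀ (p : Ω × Ω) {C : Set (Ω × Ω)}, MeasurableSet C → T p C = Measure.dirac p.swap C) :
    Kernel.Invariant T (π.prod π) := by
  have hTe : T = Kernel.deterministic Prod.swap measurable_swap := by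
    ext p C hC
    rw [hT p hC, Kernel.deterministic_apply]
  show (π.prod π).bind T = π.prod π
  rw [hTe, Measure.deterministic_comp_eq_map, Measure.prod_swap]

/-! ## §2 Cloning a walker is not exact -/

/-- **THE LAW AFTER A CLONE**: `((π ⊗ π)C)(A ×ˢ B) = π(Ω)·π(A ∩ B)` — both walkers carry the old walker 2. [ours] -/
theorem cloneWalker_bind_apply [SFinite π] (C : Kernel (Ω × Ω) (Ω × Ω))
    (hC : ∀ (p : Ω × Ω) {D : Set (Ω × Ω)}, MeasurableSet D → C p D = Measure.dirac (p.2, p.2) D) {A B : Set Ω}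
    (hA : MeasurableSet A) (hB : MeasurableSet B) : ((π.prod π).bind C) (A ×ˢ B) = π Set.univ * π (A ∩ B) := by
  rw [Measure.bind_apply (hA.prod hB) (Kernel.aemeasurable _)]
  simp_rw [hC _ (hA.prod hB)]
  have h : ∀ p : Ω × Ω, Measure.dirac (p.2, p.2) (A ×ˢ B) = (A ∩ B).indicator 1 p.2 := fun p => by
    rw [Measure.dirac_apply' _ (hA.prod hB)]
    by_cases hp : p.2 ∈ A ∩ B
    · rw [Set.indicator_of_mem (show (p.2, p.2) ∈ A ×ˢ B from ⟨hp.1, hp.2⟩), Set.indicator_of_mem hp, Pi.one_apply, Pi.one_apply]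
    · rw [Set.indicator_of_notMem hp, Set.indicator_of_notMem]
      exact fun h' => hp ⟨h'.1, h'.2⟩
  simp_rw [h]
  rw [lintegral_prod (fun a : Ω × Ω => (A ∩ B).indicator 1 a.2)
    ((measurable_one.indicator (hA.inter hB)).comp measurable_snd).aemeasurable]
  dsimp only
  rw [lintegral_indicator_one (hA.inter hB), lintegral_const, mul_comm]

/-- **CLONING IS NOT EXACT**: if `π` charges a measurable `A` and its complement, `π ⊗ π` is not invariant under the clone — the mass of
`A ×ˢ Aᶜ` drops from `π(A)π(Aᶜ) > 0` to `0`. [ours] -/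
theorem cloneWalker_not_invariant [IsProbabilityMeasure π] (C : Kernel (Ω × Ω) (Ω × Ω))
    (hC : ∀ (p : Ω × Ω) {D : Set (Ω × Ω)}, MeasurableSet D → C p D = Measure.dirac (p.2, p.2) D) {A : Set Ω} (hA : MeasurableSet A)
    (hA0 : π A ≠ 0) (hAc : π Aᶜ ≠ 0) : ¬ Kernel.Invariant C (π.prod π) := by
  intro h
  have h1 := congrArg (fun μ : Measure (Ω × Ω) => μ (A ×ˢ Aᶜ)) h.def
  rw [cloneWalker_bind_apply C hC hA hA.compl, Set.inter_compl_self, measure_empty, mul_zero, Measure.prod_prod] at h1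
  exact (mul_ne_zero hA0 hAc) h1.symm

/-! ## §3 Re-seeding a walker from the flow: untested is biased, tested is exact -/

/-- **THE LAW AFTER AN UNTESTED REFRESH FROM THE FLOW**: `(π ⊗ π)R = π(Ω)·(q ⊗ π)`. [ours] -/
theorem untestedRefresh_bind_eq [SFinite π] (q : Measure Ω) [SFinite q] (R : Kernel (Ω × Ω) (Ω × Ω))
    (hR : ∀ (p : Ω × Ω) {D : Set (Ω × Ω)}, MeasurableSet D → R p D = (q.prod (Measure.dirac p.2)) D) :
    (π.prod π).bind R = π Set.univ • q.prod π := by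
  ext D hD
  have hsec : ∀ x' : Ω, (q.prod (Measure.dirac x')) D = q ((fun y => (y, x')) ⁻¹' D) := fun x' => by
    rw [Measure.prod_apply_symm hD, lintegral_dirac' _ (measurable_measure_prodMk_right hD)]
  rw [Measure.bind_apply hD (Kernel.aemeasurable _), Measure.smul_apply, smul_eq_mul]
  simp_rw [hR _ hD, hsec]
  rw [lintegral_prod (fun a : Ω × Ω => q ((fun y => (y, a.2)) ⁻¹' D))
    ((measurable_measure_prodMk_right hD).comp measurable_snd).aemeasurable]
  dsimp only
  rw [lintegral_const, ← Measure.prod_apply_symm hD, mul_comm]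

/-- **AN UNTESTED REFRESH IS NOT EXACT UNLESS THE FLOW IS THE TARGET**: if `q(A) ≠ π(A)` for one measurable `A`, `π ⊗ π` is not
invariant. [ours] -/
theorem untestedRefresh_not_invariant [IsProbabilityMeasure π] (q : Measure Ω) [IsProbabilityMeasure q]
    (R : Kernel (Ω × Ω) (Ω × Ω)) (hR : ∀ (p : Ω × Ω) {D : Set (Ω × Ω)}, MeasurableSet D → R p D = (q.prod (Measure.dirac p.2)) D)
    {A : Set Ω} (hqA : q A ≠ π A) : ¬ Kernel.Invariant R (π.prod π) := by
  intro h
  have h1 := congrArg (fun μ : Measure (Ω × Ω) => μ (A ×ˢ Set.univ)) h.def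
  rw [untestedRefresh_bind_eq q R hR, measure_univ, one_smul, Measure.prod_prod, Measure.prod_prod, measure_univ, mul_one,
    mul_one] at h1
  exact hqA h1

/-- **THE TESTED REFRESH IS EXACT**: overwrite walker 1 by ANY `π`-exact update that does not read walker 2 — the flow draw passed
through the accept ∕ reject step of `indepMH`, for instance — and `π ⊗ π` is invariant. [ours] -/
theorem testedRefresh_invariant [SFinite π] (P : Kernel Ω Ω) (hP : Kernel.Invariant P π) (T : Kernel (Ω × Ω) (Ω × Ω))
    (hT : ∀ (x x' : Ω) {C : Set (Ω × Ω)}, MeasurableSet C → T (x, x') C = P x ((fun y => (y, x')) ⁻¹' C)) :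
    Kernel.Invariant T (π.prod π) := by
  refine leaveOneOut_fst_invariant (Kernel.prodMkLeft Ω P) (fun x' B hB => ?_) T (fun x x' C hC => ?_)
  · simp_rw [Kernel.prodMkLeft_apply]
    have := congrArg (fun μ : Measure Ω => μ B) hP.def
    simpa only [Measure.bind_apply hB (Kernel.aemeasurable _)] using this
  · rw [hT x x' hC, Kernel.prodMkLeft_apply]

end Summit.Ventures.LatticeQCDFlow.Exactness
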